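import Literature.NumberTheory.EllipticCurves.ModularCurveIharaLemma
import Literature.NumberTheory.EllipticCurves.HidaOrdinaryCohomologyCocycles
import Mathlib.NumberTheory.DirichletCharacter.Basic
import HarnessLib

/-!
# Degeneracy maps on `Γ₀`-cocycles: the conjugation `γ ↦ diag(d,1) γ diag(d,1)⁻¹ : Γ₀(L) → Γ₀(M)`,
# the pull-backs `π_d^* : Z¹(Γ₀(M), ·) → Z¹(Γ₀(L), ·)`, and (narrow) Eisenstein Hecke eigenvalue systems

The COHOMOLOGICAL companion of `ModularCurveIharaLemma` (which types the degeneracy maps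
`α_*, β_*` on period HOMOLOGY `H₁(X₀(·), ℤ) = periodHomology ·`). Group cohomology of `Γ₀(N)` with
coefficients in binary forms of degree `n` over a commutative ring `R` is the tree's
`HidaCohomology.cocycles n N R` (inhomogeneous cocycles `u : Γ₀(N) → R^{n+1}`,
`u(γδ) = u(δ) + u(γ)·δ`; for `n = 0` these are exactly the homomorphisms `Γ₀(N) → R`, i.e.
`H¹(Γ₀(N), R) = Hom(Γ₀(N), R)` for the trivial module `R`), on which the Hecke operator
`T_p = [Γ₀(N) diag(1,p) Γ₀(N)]` already acts by Shimura's formula (8.3.2) through the `p + 1`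
standard representatives `β_j = (1 j; 0 p)`, `β_∞ = diag(p,1)` (`HidaCohomology.heckeU`,
`heckeUZ`; `heckeRep`, `HeckeIdx`, `heckePerm`, `heckePermElt`). This file adds the two other
structure maps of the level tower and one piece of Hecke-algebra vocabulary:

* `Gamma0.degeneracyConj h : Γ₀(L) →* Γ₀(M)` for `M d ∣ L`: `γ = (a b; c e) ↦ diag(d,1) γ diag(d,1)⁻¹
  = (a, d b; c/d, e)` — the element `δ ∈ Γ₀(M)` with `δ∞ = d·γ∞` by which the degeneracy map
  `β_d : τ ↦ dτ` acts on cycles (Darmon–Diamond–Taylor Lemma 4.28: "`α` is defined by `τ ↦ τ` and `β`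
  by `τ ↦ pτ`"; Cremona §2.4 (2.4.1)–(2.4.2)); `d = 1` is the inclusion `Γ₀(L) ≤ Γ₀(M)`
  (`Gamma0.coe_degeneracyConj_one`). Defining identity `δ · diag(d,1) = diag(d,1) · γ`
  (`Gamma0.gmat_degeneracyConj_mul_diag`).
* `cuspSymbol_degeneracyMap0`: **compatibility with the homology side** — for every
  `f ∈ S₂(Γ₀(M))`, `{∞, γ∞}_{f ∣ [Γ₀(M) diag(d,1) Γ₀(L)]} = {∞, δ∞}_f` with THIS `δ` (the tree's
  `exists_cuspSymbol_degeneracyMap0` made explicit): pulling back the period cocycle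
  `γ ↦ {∞, γ∞}_f` along `degeneracyConj` is the period cocycle of `degeneracyMap0 M L d 2 f`.
* `HidaCohomology.degeneracyPullback n M L d R h`: the pull-back
  `π_d^* = [Γ₀(M) diag(d,1) Γ₀(L)]` on cochains, `(π_d^* u)(γ) = u(δ)·diag(d,1)` — Shimura's (8.3.2)
  for the ONE-coset double coset `Γ₀(M) diag(d,1) Γ₀(L) = Γ₀(M) diag(d,1)` (`diag(d,1) γ = δ diag(d,1)`,
  trivial permutation); it preserves cocycles (`degeneracyPullback_mem_cocycles`,
  `degeneracyPullbackZ`); for `n = 0` it is plain composition `u ↦ u ∘ δ`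
  (`degeneracyPullback_zero_apply`), and for `d = 1` restriction (`degeneracyPullback_one_apply`).
  In the notation of modular curves: `π_1^*` = restriction along `Γ₀(L) ≤ Γ₀(M)`,
  `(π_t^* φ)(γ) = φ(diag(t,1) γ diag(t,1)⁻¹)`. Transitivity: `Gamma0.degeneracyConj_degeneracyConj`,
  `degeneracyPullback_degeneracyPullback` (`π_{d₁}^* ∘ π_{d₂}^* = π_{d₂d₁}^*`, e.g. `π_{t^{n-1}}^* π_t^* = π_{t^n}^*`).
* `IsEisensteinEigensystem k λ` / `IsNarrowEisensteinEigensystem k λ` for a system of Hecke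
  eigenvalues `λ : ℕ → K` (values at primes away from a finite set): `λ(ℓ) = ψ(ℓ) + ℓ^{k-1} φ(ℓ)`
  for Dirichlet characters `ψ, φ` — the Hecke eigenvalues of the Eisenstein series `E_k^{ψ,φ}`
  (Diamond–Shurman Prop. 5.2.3: "`T_p E_k^{ψ,φ,t} = (ψ(p) + φ(p)p^{k−1}) E_k^{ψ,φ,t}` … if `p ∤ N`") —
  resp. the NARROW case `ψ = φ = η`, `λ(ℓ) = (1 + ℓ^{k-1}) η(ℓ)`; a maximal ideal `𝔪` of a Hecke
  algebra acting on `H¹(Γ₀(L), K)` is (narrow-)Eisenstein when its eigenvalue system is.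
  Compare Darmon–Diamond–Taylor p. 120 ("`𝔫` is Eisenstein if `T_p ≡ p + 1 mod 𝔫` for all
  `p ≡ 1 mod N`", the tree's `HeckeRing0.primeTo.IsEisenstein`): a narrow-Eisenstein system of
  weight `2` with `η` of modulus dividing `N` satisfies that congruence at every `ℓ ≡ 1 mod N`.
* `HeckeRing0.primeTo.IsNarrowEisenstein 𝔫`: the ideal-level companion for an ideal `𝔫` of the tree's
  prime-to-`S` Hecke ring `𝕋̃ = ℤ[T_r : r ∤ S]` (`ModularCurveIharaLemma`): `T_r ≡ (1 + r^{k−1}) χ(r) (mod 𝔫)`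
  for a Dirichlet character `χ` with values in `𝕋̃/𝔫`, away from finitely many `r` — the hypothesis shape
  «`𝔫` not narrow-Eisenstein» for Ihara-type cokernel statements in the elementwise currency of
  `ribet1984_iharaLemma` (`IsNarrowEisenstein.isNarrowEisensteinEigensystem` links the two levels).
* `HidaCohomology.IsHeckeGenEigenvector S λ u`: `u ∈ Z¹(Γ₀(N), K^{n+1})` lies in the generalised
  eigenspace of `T_ℓ` (`heckeUZ`) for the eigenvalue `λ(ℓ)` at every prime `ℓ ∉ S` — membership in the
  localisation `Z¹[𝔪_λ^∞]` at the maximal ideal `𝔪_λ = (T_ℓ − λ(ℓ) : ℓ ∉ S)` of the Hecke algebra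
  generated by the `T_ℓ`, `ℓ ∉ S`, written with Mathlib's `Module.End.maxGenEigenspace` (no Hecke
  ring of endomorphisms of `Z¹` is introduced).
* `HidaCohomology.cocyclesZeroEquiv N R : cocycles 0 N R ≃ₗ[R] (Additive (Gamma0 N) →+ R)`: degree-`0`
  cocycles ARE the homomorphisms `Γ₀(N) → R` (Shimura §8.1 with trivial action), for users who prefer
  Mathlib's bundled-hom API (`AddMonoidHom.ker`, abelianisation).

Design: levels are natural numbers and the divisibility `M d ∣ L` is an explicit hypothesis, exactly
as for the tree's `degeneracyMap0 M L d k` on cusp forms (Atkin–Lehner's `ι_d`), so that the two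
sides match literally (`cuspSymbol_degeneracyMap0`). Everything here is a definition with a body or
a proved lemma; no named facts. NOT here: the Hecke-equivariance `T_ℓ ∘ π_d^* = π_d^* ∘ T_ℓ`
(`ℓ ∤ dL`) on cocycles (the homology-side analogue is `heckeT_degeneracyMap0`), parabolic
conditions (see `HidaOrdinaryCohomologyParabolic.homSp/parSp`), and any statement about kernels of
`π_1^* − π_t^*` (Ihara-type lemmas live with their sources, cf. `ribet1984_iharaLemma`).
-- TODO(general form): `π_d^*` for `Γ₁(N)` and for a general commensurable pair (Shimura (8.3.1)).

Requested by cell `bsd-f2-manin` (typing ask T-es-12: vocabulary for a cohomological relative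
Ihara statement at primes dividing the level); PARTITION: 0 (vocabulary only; nothing here proves
BSD or a Manin-constant statement).

## References

* G. Shimura, *Introduction to the arithmetic theory of automorphic functions*, Iwanami Shoten /
  Princeton UP 1971, §8.3, (8.3.1)–(8.3.2) (p. 237: "Let `Γ₁ α Γ₂ = ⋃ Γ₁ αᵢ` … `αᵢ γ = γᵢ α_j` …
  `v(γ) = Σ αᵢ^ι u(γᵢ)`"). [cite: Shimura1971, §8.3 (8.3.1)–(8.3.2)]
* H. Darmon, F. Diamond, R. Taylor, *Fermat's Last Theorem*, CDM 1995, Lemma 4.28 (p. 135) and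
  §4.3 p. 120 (Eisenstein maximal ideals). [cite: DarmonDiamondTaylor1995, Lemma 4.28 (p. 135); §4.3 (p. 120)]
* J. E. Cremona, *Algorithms for modular elliptic curves*, 2nd ed. 1997, §2.4 (2.4.1)–(2.4.2).
  [cite: CremonaAlgorithms1997, §2.4]
* F. Diamond, J. Shurman, *A first course in modular forms*, GTM 228, Springer 2005, Prop. 5.2.3
  (p. 173). [cite: DiamondShurman2005, Prop. 5.2.3 (p. 173)]
-/

noncomputable section

open scoped MatrixGroups ModularForm

open CongruenceSubgroup Matrix

namespace Literature.NumberTheory.EllipticCurves.ModularForms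

/-! ### The conjugation `γ ↦ diag(d,1) γ diag(d,1)⁻¹ : Γ₀(L) → Γ₀(M)` for `M d ∣ L` -/

section Conj

variable {M L d : ℕ}

/-- For `M d ∣ L` and `γ ∈ Γ₀(L)`, `M d` divides the lower-left entry of `γ` (plumbing). [folklore] -/
private theorem Gamma0.mul_dvd_apply_one_zero (h : M * d ∣ L) (γ : Gamma0 L) :
    ((M : ℤ) * d) ∣ (γ : SL(2, ℤ)) 1 0 := by
  have hL : (L : ℤ) ∣ (γ : SL(2, ℤ)) 1 0 := by
    have hγ := γ.2
    rw [Gamma0_mem] at hγ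
    exact (ZMod.intCast_zmod_eq_zero_iff_dvd _ L).mp hγ
  have hML : ((M : ℤ) * d) ∣ (L : ℤ) := by exact_mod_cast h
  exact hML.trans hL

/-- For `M d ∣ L` and `γ ∈ Γ₀(L)`, `d` divides the lower-left entry of `γ` (plumbing). [folklore] -/
private theorem Gamma0.dvd_apply_one_zero (h : M * d ∣ L) (γ : Gamma0 L) :
    (d : ℤ) ∣ (γ : SL(2, ℤ)) 1 0 :=
  (dvd_mul_left (d : ℤ) M).trans (Gamma0.mul_dvd_apply_one_zero h γ)

/-- The matrix `diag(d,1) γ diag(d,1)⁻¹ = (a, d b; c/d, e)` of `γ = (a b; c e) ∈ Γ₀(L)`, for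
`M d ∣ L`, as an element of `Γ₀(M)`: determinant `a e − (d b)(c/d) = a e − b c = 1` and `M ∣ c/d`
because `M d ∣ c`. This is the `δ ∈ Γ₀(M)` with `δ∞ = d · γ∞` of Darmon–Diamond–Taylor's
degeneracy map "`β` by `τ ↦ pτ`" on cycles and of Cremona §2.4 ("`⟨{α, β}, f ∣ M⟩ = ⟨{Mα, Mβ}, f⟩`"
with `M = diag(d,1)`), cf. `exists_cuspSymbol_degeneracyMap0`.
[cite: DarmonDiamondTaylor1995, Lemma 4.28 (p. 135)] -/
def Gamma0.degeneracyConjElt (h : M * d ∣ L) (γ : Gamma0 L) : Gamma0 M :=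
  ⟨⟨!![(γ : SL(2, ℤ)) 0 0, (d : ℤ) * (γ : SL(2, ℤ)) 0 1;
        (γ : SL(2, ℤ)) 1 0 / d, (γ : SL(2, ℤ)) 1 1], by
      rw [Matrix.det_fin_two_of]
      have hdet := Matrix.det_fin_two (γ : SL(2, ℤ)).1
      rw [(γ : SL(2, ℤ)).2] at hdet
      have hdc : (d : ℤ) * ((γ : SL(2, ℤ)) 1 0 / d) = (γ : SL(2, ℤ)) 1 0 :=
        Int.mul_ediv_cancel' (Gamma0.dvd_apply_one_zero h γ)
      linear_combination -hdet - ((γ : SL(2, ℤ)) 0 1) * hdc⟩,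
    by
      rw [Gamma0_mem]
      change (((γ : SL(2, ℤ)) 1 0 / d : ℤ) : ZMod M) = 0
      refine (ZMod.intCast_zmod_eq_zero_iff_dvd _ M).mpr ?_
      obtain ⟨k, hk⟩ := Gamma0.mul_dvd_apply_one_zero h γ
      by_cases hd : (d : ℤ) = 0
      · rw [hk, hd]; simp
      · refine ⟨k, ?_⟩
        rw [hk, show (M : ℤ) * d * k = d * (M * k) by ring, Int.mul_ediv_cancel_left _ hd]⟩

/-- Top-left entry of `δ = diag(d,1) γ diag(d,1)⁻¹`: `a` (Cremona §2.4: the matrix `M γ M⁻¹`,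
`M = diag(d,1)`). [cite: CremonaAlgorithms1997, §2.4 (2.4.1)–(2.4.2)] -/
@[simp] theorem Gamma0.degeneracyConjElt_apply_zero_zero (h : M * d ∣ L) (γ : Gamma0 L) :
    ((Gamma0.degeneracyConjElt h γ : Gamma0 M) : SL(2, ℤ)) 0 0 = (γ : SL(2, ℤ)) 0 0 := rfl

/-- Top-right entry of `δ = diag(d,1) γ diag(d,1)⁻¹`: `d b`. [cite: CremonaAlgorithms1997, §2.4 (2.4.1)–(2.4.2)] -/
@[simp] theorem Gamma0.degeneracyConjElt_apply_zero_one (h : M * d ∣ L) (γ : Gamma0 L) :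
    ((Gamma0.degeneracyConjElt h γ : Gamma0 M) : SL(2, ℤ)) 0 1 = (d : ℤ) * (γ : SL(2, ℤ)) 0 1 := rfl

/-- Bottom-left entry of `δ = diag(d,1) γ diag(d,1)⁻¹`: `c / d` (an exact division, `d ∣ c`).
[cite: CremonaAlgorithms1997, §2.4 (2.4.1)–(2.4.2)] -/
@[simp] theorem Gamma0.degeneracyConjElt_apply_one_zero (h : M * d ∣ L) (γ : Gamma0 L) :
    ((Gamma0.degeneracyConjElt h γ : Gamma0 M) : SL(2, ℤ)) 1 0 = (γ : SL(2, ℤ)) 1 0 / d := rfl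

/-- Bottom-right entry of `δ = diag(d,1) γ diag(d,1)⁻¹`: `e`. [cite: CremonaAlgorithms1997, §2.4 (2.4.1)–(2.4.2)] -/
@[simp] theorem Gamma0.degeneracyConjElt_apply_one_one (h : M * d ∣ L) (γ : Gamma0 L) :
    ((Gamma0.degeneracyConjElt h γ : Gamma0 M) : SL(2, ℤ)) 1 1 = (γ : SL(2, ℤ)) 1 1 := rfl

/-- **Defining identity** `δ · diag(d,1) = diag(d,1) · γ` for `δ = diag(d,1) γ diag(d,1)⁻¹`, as
integer matrices (Shimura's `αᵢ γ = γᵢ αⱼ` for the one-coset double coset `Γ₀(M) diag(d,1) Γ₀(L)`).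
[cite: Shimura1971, §8.3 p. 237] -/
theorem Gamma0.gmat_degeneracyConjElt_mul_diag (h : M * d ∣ L) (γ : Gamma0 L) :
    HidaCohomology.gmat (Gamma0.degeneracyConjElt h γ) * !![(d : ℤ), 0; 0, 1] =
      !![(d : ℤ), 0; 0, 1] * HidaCohomology.gmat γ := by
  have hdc : (γ : SL(2, ℤ)) 1 0 / d * (d : ℤ) = (γ : SL(2, ℤ)) 1 0 :=
    Int.ediv_mul_cancel (Gamma0.dvd_apply_one_zero h γ)
  ext i j
  fin_cases i <;> fin_cases j <;>
    simp [HidaCohomology.gmat, Gamma0.degeneracyConjElt, Matrix.mul_apply, Fin.sum_univ_two, hdc,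
      mul_comm]

/-- An element of `Γ₀(N)` is determined by its integer matrix (plumbing). [folklore] -/
private theorem Gamma0.ext_gmat {N : ℕ} {γ δ : Gamma0 N}
    (hγδ : HidaCohomology.gmat γ = HidaCohomology.gmat δ) : γ = δ :=
  Subtype.ext (Matrix.SpecialLinearGroup.ext _ _ fun i j ↦ congrFun (congrFun hγδ i) j)

variable (M L d) in
/-- **The degeneracy conjugation** `Γ₀(L) →* Γ₀(M)`, `γ ↦ diag(d,1) γ diag(d,1)⁻¹ = (a, d b; c/d, e)`
(`M d ∣ L`), as a group homomorphism: the map on fundamental groups / `1`-cycles underlying the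
degeneracy map `β_d : Y₀(L) → Y₀(M)`, `τ ↦ dτ` (Darmon–Diamond–Taylor Lemma 4.28; for `d = 1` the
inclusion `Γ₀(L) ≤ Γ₀(M)`, `Gamma0.coe_degeneracyConj_one`). Multiplicativity is conjugation:
from `δ diag(d,1) = diag(d,1) γ` (`Gamma0.gmat_degeneracyConjElt_mul_diag`) by cancelling
`diag(d,1)`. [cite: DarmonDiamondTaylor1995, Lemma 4.28 (p. 135)] -/
def Gamma0.degeneracyConj [NeZero d] (h : M * d ∣ L) : Gamma0 L →* Gamma0 M :=
  MonoidHom.mk' (Gamma0.degeneracyConjElt h) fun γ γ' ↦ by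
    apply Gamma0.ext_gmat
    have hD : (!![(d : ℤ), 0; 0, 1] : Matrix (Fin 2) (Fin 2) ℤ).det ≠ 0 := by
      rw [Matrix.det_fin_two_of]; simpa using NeZero.ne d
    apply matrix_mul_right_cancel_of_det_ne_zero hD
    rw [HidaCohomology.gmat_mul (Gamma0.degeneracyConjElt h γ), Matrix.mul_assoc,
      Gamma0.gmat_degeneracyConjElt_mul_diag h γ', ← Matrix.mul_assoc,
      Gamma0.gmat_degeneracyConjElt_mul_diag h γ, Gamma0.gmat_degeneracyConjElt_mul_diag h (γ * γ'),
      HidaCohomology.gmat_mul γ γ', Matrix.mul_assoc]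

/-- Unfolding `Gamma0.degeneracyConj`: its value at `γ` is the matrix `(a, d b; c/d, e)`.
[cite: DarmonDiamondTaylor1995, Lemma 4.28 (p. 135)] -/
@[simp] theorem Gamma0.degeneracyConj_apply [NeZero d] (h : M * d ∣ L) (γ : Gamma0 L) :
    Gamma0.degeneracyConj M L d h γ = Gamma0.degeneracyConjElt h γ := rfl

/-- `δ · diag(d,1) = diag(d,1) · γ` for `δ = Gamma0.degeneracyConj M L d h γ`. [cite: Shimura1971, §8.3 p. 237] -/
theorem Gamma0.gmat_degeneracyConj_mul_diag [NeZero d] (h : M * d ∣ L) (γ : Gamma0 L) :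
    HidaCohomology.gmat (Gamma0.degeneracyConj M L d h γ) * !![(d : ℤ), 0; 0, 1] =
      !![(d : ℤ), 0; 0, 1] * HidaCohomology.gmat γ :=
  Gamma0.gmat_degeneracyConjElt_mul_diag h γ

/-- For `d = 1` the degeneracy conjugation is the inclusion `Γ₀(L) ≤ Γ₀(M)` (`M ∣ L`): same matrix —
Darmon–Diamond–Taylor's first degeneracy map "`α` is defined by `τ ↦ τ`".
[cite: DarmonDiamondTaylor1995, Lemma 4.28 (p. 135)] -/
@[simp] theorem Gamma0.coe_degeneracyConj_one (h : M * 1 ∣ L) (γ : Gamma0 L) :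
    ((Gamma0.degeneracyConj M L 1 h γ : Gamma0 M) : SL(2, ℤ)) = (γ : SL(2, ℤ)) := by
  ext i j
  fin_cases i <;> fin_cases j <;> simp [Gamma0.degeneracyConjElt]

/-- `diag(d₂,1) · diag(d₁,1) = diag(d₂ d₁, 1)` (plumbing). [folklore] -/
private theorem diag_mul_diag (d₁ d₂ : ℕ) :
    (!![(d₂ : ℤ), 0; 0, 1] : Matrix (Fin 2) (Fin 2) ℤ) * !![(d₁ : ℤ), 0; 0, 1] = !![((d₂ * d₁ : ℕ) : ℤ), 0; 0, 1] := by
  ext i j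
  fin_cases i <;> fin_cases j <;> simp [Matrix.mul_apply, Fin.sum_univ_two]

/-- **Transitivity of the degeneracy conjugations**: conjugating by `diag(d₁,1)` from level `L` to `L₁` and then
by `diag(d₂,1)` from `L₁` to `M` is conjugating by `diag(d₂ d₁, 1)` from `L` to `M` — the composition law
`β_{d₂} ∘ β_{d₁} = β_{d₂ d₁}` of the degeneracy maps (on forms: the tree's `degeneracyMap0_comp`; Darmon–Diamond–Taylor
§4.5 composes `X₀(Np²) → X₀(Np) → X₀(N)`). [cite: DarmonDiamondTaylor1995, Lemma 4.28 and §4.5 (p. 137)] -/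
theorem Gamma0.degeneracyConj_degeneracyConj {L₁ d₁ d₂ : ℕ} [NeZero d₁] [NeZero d₂] (h₁ : L₁ * d₁ ∣ L)
    (h₂ : M * d₂ ∣ L₁) (h : M * (d₂ * d₁) ∣ L) (γ : Gamma0 L) :
    Gamma0.degeneracyConj M L₁ d₂ h₂ (Gamma0.degeneracyConj L₁ L d₁ h₁ γ) =
      Gamma0.degeneracyConj M L (d₂ * d₁) h γ := by
  apply Gamma0.ext_gmat
  have hD : (!![((d₂ * d₁ : ℕ) : ℤ), 0; 0, 1] : Matrix (Fin 2) (Fin 2) ℤ).det ≠ 0 := by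
    rw [Matrix.det_fin_two_of]; simpa using And.intro (NeZero.ne d₂) (NeZero.ne d₁)
  apply matrix_mul_right_cancel_of_det_ne_zero hD
  rw [Gamma0.gmat_degeneracyConj_mul_diag, ← diag_mul_diag, ← Matrix.mul_assoc,
    Gamma0.gmat_degeneracyConj_mul_diag, Matrix.mul_assoc, Gamma0.gmat_degeneracyConj_mul_diag,
    Matrix.mul_assoc]

end Conj

/-! ### Compatibility with the degeneracy maps on cusp forms and period homology -/

section Bridge

variable {M L d : ℕ} [NeZero M] [NeZero L] [NeZero d]

/-- **The period cocycle of `f ∣ [Γ₀(M) diag(d,1) Γ₀(L)]` is the pull-back of the period cocycle of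
`f`**: for `M d ∣ L`, `f ∈ S₂(Γ₀(M))` and `γ ∈ Γ₀(L)`,
`{∞, γ∞}_{degeneracyMap0 M L d 2 f} = {∞, δ∞}_f` with `δ = diag(d,1) γ diag(d,1)⁻¹ ∈ Γ₀(M)`
(`δ∞ = d · γ∞`): the substitution `s = dt` in `2π ∫₀^∞ d f(d(r + it)) dt`, Cremona (2.4.1)–(2.4.2)
with `M = diag(d,1)` (tree: `modularSymbol_slash_tpD`, `coe_degeneracyMap0`); this is
`exists_cuspSymbol_degeneracyMap0` with the witness made explicit and functorial in `γ`.
[cite: CremonaAlgorithms1997, §2.4 (2.4.1)–(2.4.2)] -/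
theorem cuspSymbol_degeneracyMap0 (h : M * d ∣ L) (f : CuspForm (Gamma0 M) 2) (γ : Gamma0 L) :
    cuspSymbol (degeneracyMap0 M L d 2 f) γ = cuspSymbol f (Gamma0.degeneracyConj M L d h γ) := by
  set a : ℤ := (γ : SL(2, ℤ)) 0 0 with ha
  set c : ℤ := (γ : SL(2, ℤ)) 1 0 with hc
  have hd0 : (d : ℤ) ≠ 0 := by exact_mod_cast NeZero.ne d
  have hdc : (d : ℤ) ∣ c := Gamma0.dvd_apply_one_zero h γ
  have hc0 : c = 0 ↔ c / d = 0 := by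
    constructor
    · intro h0; rw [h0, Int.zero_ediv]
    · intro h0
      have := Int.ediv_mul_cancel hdc
      rw [h0, zero_mul] at this
      exact this.symm
  have hδ10 : ((Gamma0.degeneracyConj M L d h γ : Gamma0 M) : SL(2, ℤ)) 1 0 = c / d := rfl
  have hδ00 : ((Gamma0.degeneracyConj M L d h γ : Gamma0 M) : SL(2, ℤ)) 0 0 = a := rfl
  by_cases hcz : c = 0
  · -- both cusps are `∞`
    have h1 : (γ : SL(2, ℤ)) 1 0 = 0 := by rw [← hc]; exact hcz
    have h2 : ((Gamma0.degeneracyConj M L d h γ : Gamma0 M) : SL(2, ℤ)) 1 0 = 0 := by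
      rw [hδ10]; exact hc0.mp hcz
    rw [cuspSymbol, if_pos h1, cuspSymbol, if_pos h2]
  · have hc'z : c / d ≠ 0 := fun h0 ↦ hcz (hc0.mpr h0)
    have h1 : (γ : SL(2, ℤ)) 1 0 ≠ 0 := by rw [← hc]; exact hcz
    have h2 : ((Gamma0.degeneracyConj M L d h γ : Gamma0 M) : SL(2, ℤ)) 1 0 ≠ 0 := by
      rw [hδ10]; exact hc'z
    rw [cuspSymbol, if_neg h1, cuspSymbol, if_neg h2, hδ10, hδ00, ← ha, ← hc]
    -- `{∞, a/(c/d)}_f = {∞, d a/c}_f = {∞, a/c}_{f ∣ diag(d,1)}`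
    have hq : (a : ℚ) / ((c / d : ℤ) : ℚ) = d * ((a : ℚ) / (c : ℚ)) := by
      have hcq : (c : ℚ) ≠ 0 := by exact_mod_cast hcz
      have hdq : (d : ℚ) ≠ 0 := by exact_mod_cast NeZero.ne d
      rw [Int.cast_div hdc (by exact_mod_cast hd0)]
      push_cast
      field_simp
    rw [hq, ← modularSymbol_slash_tpD d f, modularSymbol, coe_degeneracyMap0 M L d 2 h f]

/-- The same compatibility for the period functionals `{∞, γ∞} ∈ S₂(Γ₀(·))^∨`: the transpose of
`degeneracyMap0 M L d 2` (the map `β_{d,*}` on `H₁(X₀(L), ℤ) = periodHomology L` of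
`ModularCurveIharaLemma`) sends `{∞, γ∞}` to `{∞, δ∞}`, `δ = Gamma0.degeneracyConj M L d h γ`.
[cite: DarmonDiamondTaylor1995, Lemma 4.28 (p. 135)] -/
theorem dualMap_degeneracyMap0_periodFunctional (h : M * d ∣ L) (γ : Gamma0 L) :
    (degeneracyMap0 M L d 2).dualMap (periodFunctional L γ) =
      periodFunctional M (Gamma0.degeneracyConj M L d h γ) := by
  ext f
  simp [cuspSymbol_degeneracyMap0 h f γ]

end Bridge

/-! ### (Narrow) Eisenstein systems of Hecke eigenvalues -/

section Eisenstein

variable {K : Type*} [CommRing K]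

/-- A system `λ : ℕ → K` of Hecke eigenvalues (read at primes `ℓ`, away from a finite set `S`) is
**Eisenstein of weight `k`** if `λ(ℓ) = ψ(ℓ) + ℓ^{k−1} φ(ℓ)` for all primes `ℓ ∉ S`, for some
Dirichlet characters `ψ, φ` (of some common modulus `m ≥ 1`) with values in `K`: these are the Hecke
eigenvalues of the Eisenstein series `E_k^{ψ,φ}` away from the level — Diamond–Shurman Prop. 5.2.3:
"`T_p E_k^{ψ,φ,t} = (ψ(p) + φ(p)p^{k−1}) E_k^{ψ,φ,t}` if `uv = N` or if `p ∤ N`". A maximal ideal `𝔪`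
of a Hecke algebra `𝕋 = K[T_ℓ : ℓ ∉ S]` is called Eisenstein when the system `ℓ ↦ T_ℓ mod 𝔪` is
(values in `k(𝔪)`); compare Darmon–Diamond–Taylor p. 120 (`T_p ≡ p + 1 mod 𝔫` for `p ≡ 1 mod N`,
the tree's `HeckeRing0.primeTo.IsEisenstein`), which every weight-`2` Eisenstein system with
characters of modulus dividing `N` satisfies. Only `k ≥ 1` is meaningful (for `k = 0` the exponent
`k − 1` is the truncated `0`). [cite: DiamondShurman2005, Prop. 5.2.3 (p. 173)] -/
def IsEisensteinEigensystem (k : ℕ) (lam : ℕ → K) : Prop :=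
  ∃ (S : Finset ℕ) (m : ℕ) (ψ φ : DirichletCharacter K m), 0 < m ∧
    ∀ ℓ : ℕ, ℓ.Prime → ℓ ∉ S → lam ℓ = ψ (ℓ : ZMod m) + (ℓ : K) ^ (k - 1) * φ (ℓ : ZMod m)

/-- A system `λ : ℕ → K` of Hecke eigenvalues is **narrow-Eisenstein of weight `k`** if
`λ(ℓ) = (1 + ℓ^{k−1}) η(ℓ)` for all primes `ℓ` outside a finite set, for ONE Dirichlet character
`η` (of some modulus `m ≥ 1`) with values in `K`: the Eisenstein system of `E_k^{η,η}` (Diamond–Shurman Prop. 5.2.3 with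
`ψ = φ = η`), i.e. the case `ψ = φ` of `IsEisensteinEigensystem`
(`IsNarrowEisensteinEigensystem.isEisensteinEigensystem`). In weight `2` and residue characteristic
`p` this is the congruence `T_ℓ ≡ (ℓ + 1) η(ℓ)`, i.e. the semisimple residual representation
`η ⊕ η χ_p`. [cite: DiamondShurman2005, Prop. 5.2.3 (p. 173)] -/
def IsNarrowEisensteinEigensystem (k : ℕ) (lam : ℕ → K) : Prop :=
  ∃ (S : Finset ℕ) (m : ℕ) (χ : DirichletCharacter K m), 0 < m ∧
    ∀ ℓ : ℕ, ℓ.Prime → ℓ ∉ S → lam ℓ = (1 + (ℓ : K) ^ (k - 1)) * χ (ℓ : ZMod m)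

/-- Unfolding `IsEisensteinEigensystem`. [cite: DiamondShurman2005, Prop. 5.2.3 (p. 173)] -/
theorem isEisensteinEigensystem_iff (k : ℕ) (lam : ℕ → K) :
    IsEisensteinEigensystem k lam ↔ ∃ (S : Finset ℕ) (m : ℕ) (ψ φ : DirichletCharacter K m),
      0 < m ∧ ∀ ℓ : ℕ, ℓ.Prime → ℓ ∉ S →
        lam ℓ = ψ (ℓ : ZMod m) + (ℓ : K) ^ (k - 1) * φ (ℓ : ZMod m) :=
  Iff.rfl

/-- Unfolding `IsNarrowEisensteinEigensystem`. [cite: DiamondShurman2005, Prop. 5.2.3 (p. 173)] -/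
theorem isNarrowEisensteinEigensystem_iff (k : ℕ) (lam : ℕ → K) :
    IsNarrowEisensteinEigensystem k lam ↔ ∃ (S : Finset ℕ) (m : ℕ) (χ : DirichletCharacter K m),
      0 < m ∧ ∀ ℓ : ℕ, ℓ.Prime → ℓ ∉ S → lam ℓ = (1 + (ℓ : K) ^ (k - 1)) * χ (ℓ : ZMod m) :=
  Iff.rfl

/-- A narrow-Eisenstein system is Eisenstein (`ψ = φ = η`). [cite: DiamondShurman2005, Prop. 5.2.3 (p. 173)] -/
theorem IsNarrowEisensteinEigensystem.isEisensteinEigensystem {k : ℕ} {lam : ℕ → K}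
    (h : IsNarrowEisensteinEigensystem k lam) : IsEisensteinEigensystem k lam := by
  obtain ⟨S, m, χ, hm, hχ⟩ := h
  refine ⟨S, m, χ, χ, hm, fun ℓ hℓ hℓS ↦ ?_⟩
  rw [hχ ℓ hℓ hℓS]
  ring

/-- The system changed at finitely many primes stays narrow-Eisenstein: the notion only sees
`λ` away from a finite set. [cite: DiamondShurman2005, Prop. 5.2.3 (p. 173)] -/
theorem IsNarrowEisensteinEigensystem.congr {k : ℕ} {lam lam' : ℕ → K} (S' : Finset ℕ)
    (h : IsNarrowEisensteinEigensystem k lam) (hS' : ∀ ℓ : ℕ, ℓ.Prime → ℓ ∉ S' → lam' ℓ = lam ℓ) :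
    IsNarrowEisensteinEigensystem k lam' := by
  obtain ⟨S, m, χ, hm, hχ⟩ := h
  refine ⟨S ∪ S', m, χ, hm, fun ℓ hℓ hℓS ↦ ?_⟩
  rw [Finset.mem_union, not_or] at hℓS
  rw [hS' ℓ hℓ hℓS.2, hχ ℓ hℓ hℓS.1]

end Eisenstein

/-! ### Narrow-Eisenstein maximal ideals of the prime-to-`S` Hecke ring `𝕋̃ = ℤ[T_r : r ∤ S]` -/

section NarrowEisensteinIdeal

namespace HeckeRing0.primeTo

variable {N : ℕ} [NeZero N] {k : ℤ} {S : ℕ}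

/-- An ideal `𝔫` of the prime-to-`S` Hecke ring `𝕋̃ = ℤ[T_r : r ∤ S]` of level `N` and weight `k`
(`HeckeRing0.primeTo N k S`) is **narrow-Eisenstein** if the system `r ↦ T_r mod 𝔫` is narrow-Eisenstein
with values in `𝕋̃/𝔫`: for some Dirichlet character `χ` of some modulus `m ≥ 1` with values in `𝕋̃/𝔫` and
all primes `r ∤ S` outside a finite set, `T_r ≡ (1 + r^{k−1}) χ(r) (mod 𝔫)` — the congruence with the
Eisenstein series `E_k^{χ,χ}` (Diamond–Shurman Prop. 5.2.3 with `ψ = φ = χ`: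
`T_p E_k^{ψ,φ} = (ψ(p) + φ(p)p^{k−1}) E_k^{ψ,φ}` for `p ∤ N`). For weight `2` this is `T_r ≡ (r + 1) χ(r)`;
with `χ` of modulus dividing `S` it implies Darmon–Diamond–Taylor's condition `T_r ≡ r + 1 (mod 𝔫)` at every
`r ≡ 1 (mod S)` (`IsEisenstein`, p. 120). The ideal-level companion of `IsNarrowEisensteinEigensystem`.
[cite: DiamondShurman2005, Prop. 5.2.3 (p. 173)] -/
def IsNarrowEisenstein (𝔫 : Ideal (primeTo N k S)) : Prop :=
  ∃ (S' : Finset ℕ) (m : ℕ) (χ : DirichletCharacter (primeTo N k S ⧸ 𝔫) m), 0 < m ∧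
    ∀ (r : ℕ) (hr : r.Prime) (hrS : ¬ r ∣ S), r ∉ S' →
      Ideal.Quotient.mk 𝔫 (T N k S hr hrS) = (1 + (r : primeTo N k S ⧸ 𝔫) ^ (k - 1).toNat) * χ (r : ZMod m)

/-- Unfolding `IsNarrowEisenstein`. [cite: DiamondShurman2005, Prop. 5.2.3 (p. 173)] -/
theorem isNarrowEisenstein_iff (𝔫 : Ideal (primeTo N k S)) :
    IsNarrowEisenstein 𝔫 ↔ ∃ (S' : Finset ℕ) (m : ℕ) (χ : DirichletCharacter (primeTo N k S ⧸ 𝔫) m), 0 < m ∧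
      ∀ (r : ℕ) (hr : r.Prime) (hrS : ¬ r ∣ S), r ∉ S' →
        Ideal.Quotient.mk 𝔫 (T N k S hr hrS) =
          (1 + (r : primeTo N k S ⧸ 𝔫) ^ (k - 1).toNat) * χ (r : ZMod m) :=
  Iff.rfl

/-- A narrow-Eisenstein ideal has a narrow-Eisenstein system of residues `r ↦ T_r mod 𝔫` (weight
`(k − 1).toNat + 1`, i.e. `k` for `k ≥ 1`), reading `T_r := 0` at the finitely many primes `r ∣ S` (which the
notion ignores). [cite: DiamondShurman2005, Prop. 5.2.3 (p. 173)] -/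
theorem IsNarrowEisenstein.isNarrowEisensteinEigensystem [NeZero S] {𝔫 : Ideal (primeTo N k S)}
    (h : IsNarrowEisenstein 𝔫) :
    IsNarrowEisensteinEigensystem ((k - 1).toNat + 1)
      (fun r ↦ if hr : r.Prime ∧ ¬ r ∣ S then Ideal.Quotient.mk 𝔫 (T N k S hr.1 hr.2) else 0) := by
  obtain ⟨S', m, χ, hm, hχ⟩ := h
  refine ⟨S' ∪ S.primeFactors, m, χ, hm, fun r hr hrS' ↦ ?_⟩
  rw [Finset.mem_union, not_or, Nat.mem_primeFactors_of_ne_zero (NeZero.ne S)] at hrS'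
  have hrS : ¬ r ∣ S := fun hd ↦ hrS'.2 ⟨hr, hd⟩
  show (if hr : r.Prime ∧ ¬ r ∣ S then Ideal.Quotient.mk 𝔫 (T N k S hr.1 hr.2) else 0) = _
  rw [dif_pos ⟨hr, hrS⟩, hχ r hr hrS hrS'.1, Nat.add_sub_cancel]

end HeckeRing0.primeTo

end NarrowEisensteinIdeal

end Literature.NumberTheory.EllipticCurves.ModularForms

/-! ### Pull-backs `π_d^*` on cochains and cocycles; generalised Hecke eigenvectors -/

namespace Literature.NumberTheory.EllipticCurves.ModularForms.HidaCohomology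

open Literature.NumberTheory.EllipticCurves.ModularForms

/-- **The degeneracy pull-back `π_d^* = [Γ₀(M) diag(d,1) Γ₀(L)]` on cochains** `Γ₀(M) → R^{n+1}`
(`M d ∣ L`): `(π_d^* u)(γ) = u(δ)·diag(d,1)` with `δ = diag(d,1) γ diag(d,1)⁻¹ ∈ Γ₀(M)` — Shimura's
formula (8.3.2) `v(γ) = Σᵢ αᵢ^ι u(γᵢ)`, `αᵢ γ = γᵢ αⱼ`, for the double coset
`Γ₀(M) diag(d,1) Γ₀(L) = Γ₀(M) diag(d,1)` consisting of ONE right coset (so `d = 1` term,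
`γ₁ = δ`), in the right-action convention of the tree's `heckeU` (coefficient twist by the
representative itself). For `n = 0` (trivial coefficients, `Hom(Γ₀(·), R)`) it is `u ↦ u ∘ δ`
(`degeneracyPullback_zero_apply`): `π_1^*` = restriction to `Γ₀(L)`, `(π_t^* u)(γ) =
u(diag(t,1) γ diag(t,1)⁻¹)`. [cite: Shimura1971, §8.3 (8.3.1)–(8.3.2)] -/
def degeneracyPullback (n M L d : ℕ) (R : Type*) [CommRing R] [NeZero d] (h : M * d ∣ L) :
    (Gamma0 M → Fin (n + 1) → R) →ₗ[R] (Gamma0 L → Fin (n + 1) → R) where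
  toFun u γ := act n !![(d : ℤ), 0; 0, 1] (u (Gamma0.degeneracyConj M L d h γ))
  map_add' u v := by
    funext γ
    simp only [Pi.add_apply, map_add]
  map_smul' c u := by
    funext γ
    simp only [Pi.smul_apply, map_smul, RingHom.id_apply]

section Pullback

variable {n M L d : ℕ} {R : Type*} [CommRing R] [NeZero d] (h : M * d ∣ L)

/-- Unfolding `degeneracyPullback`. [cite: Shimura1971, §8.3 (8.3.2)] -/
theorem degeneracyPullback_apply (u : Gamma0 M → Fin (n + 1) → R) (γ : Gamma0 L) :
    degeneracyPullback n M L d R h u γ =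
      act n !![(d : ℤ), 0; 0, 1] (u (Gamma0.degeneracyConj M L d h γ)) := rfl

/-- In degree `0` (trivial coefficients) the pull-back is composition with the degeneracy
conjugation: `(π_d^* u)(γ) = u(diag(d,1) γ diag(d,1)⁻¹)`. [cite: Shimura1971, §8.3 (8.3.2)] -/
@[simp] theorem degeneracyPullback_zero_apply (h : M * d ∣ L) (u : Gamma0 M → Fin 1 → R)
    (γ : Gamma0 L) :
    degeneracyPullback 0 M L d R h u γ = u (Gamma0.degeneracyConj M L d h γ) := by
  rw [degeneracyPullback_apply, act_zero_eq_id, LinearMap.id_apply]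

/-- For `d = 1` the pull-back is restriction along `Γ₀(L) ≤ Γ₀(M)` (`π_1^*`): same matrix, no twist.
[cite: Shimura1971, §8.3 (8.3.2)] -/
theorem degeneracyPullback_one_apply (h : M * 1 ∣ L) (u : Gamma0 M → Fin (n + 1) → R)
    (γ : Gamma0 L) :
    degeneracyPullback n M L 1 R h u γ = u (Gamma0.degeneracyConj M L 1 h γ) := by
  rw [degeneracyPullback_apply]
  have : (!![((1 : ℕ) : ℤ), 0; 0, 1] : Matrix (Fin 2) (Fin 2) ℤ) = 1 := by
    ext i j; fin_cases i <;> fin_cases j <;> rfl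
  rw [this, act_one, LinearMap.id_apply]

/-- **`π_d^*` preserves cocycles**: from `δ(γγ') = δ(γ) δ(γ')` and `δ(γ') diag(d,1) = diag(d,1) γ'`
(the coefficient twist by `diag(d,1)` is exactly what makes the cocycle identity transport).
[cite: Shimura1971, §8.3 (8.3.2) and Prop. 8.5] -/
theorem degeneracyPullback_mem_cocycles {u : Gamma0 M → Fin (n + 1) → R} (hu : u ∈ cocycles n M R) :
    degeneracyPullback n M L d R h u ∈ cocycles n L R := by
  rw [mem_cocycles_iff] at hu ⊢
  intro γ γ'
  rw [degeneracyPullback_apply, degeneracyPullback_apply, degeneracyPullback_apply, map_mul, hu,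
    map_add, ← act_mul_apply, ← act_mul_apply, Gamma0.gmat_degeneracyConj_mul_diag]

/-- **Transitivity of the pull-backs**: `π_{d₁}^* ∘ π_{d₂}^* = π_{d₂ d₁}^*` on cochains
(`Γ₀(M) → Γ₀(L₁) → Γ₀(L)`, `M d₂ ∣ L₁`, `L₁ d₁ ∣ L`) — from `Gamma0.degeneracyConj_degeneracyConj` and
`act (D₂ D₁) = act D₁ ∘ act D₂`; the cochain form of `degeneracyMap0_comp` (Darmon–Diamond–Taylor §4.5: the
degeneracy maps of `X₀(Np²) → X₀(Np) → X₀(N)` compose). [cite: DarmonDiamondTaylor1995, Lemma 4.28 and §4.5 (p. 137)] -/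
theorem degeneracyPullback_degeneracyPullback {L₁ d₁ d₂ : ℕ} [NeZero d₁] [NeZero d₂] (h₁ : L₁ * d₁ ∣ L)
    (h₂ : M * d₂ ∣ L₁) (h' : M * (d₂ * d₁) ∣ L) (u : Gamma0 M → Fin (n + 1) → R) :
    degeneracyPullback n L₁ L d₁ R h₁ (degeneracyPullback n M L₁ d₂ R h₂ u) =
      degeneracyPullback n M L (d₂ * d₁) R h' u := by
  funext γ
  rw [degeneracyPullback_apply, degeneracyPullback_apply, degeneracyPullback_apply, ← act_mul_apply,
    Gamma0.degeneracyConj_degeneracyConj h₁ h₂ h']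
  congr 2
  ext i j
  fin_cases i <;> fin_cases j <;> simp [Matrix.mul_apply, Fin.sum_univ_two]

variable (n M L d R) in
/-- **`π_d^*` on the modules of cocycles**, `Z¹(Γ₀(M), R^{n+1}) → Z¹(Γ₀(L), R^{n+1})`.
[cite: Shimura1971, §8.3 (8.3.1)] -/
def degeneracyPullbackZ : cocycles n M R →ₗ[R] cocycles n L R :=
  (degeneracyPullback n M L d R h).restrict fun _ hu ↦ degeneracyPullback_mem_cocycles h hu

/-- Unfolding `degeneracyPullbackZ`. [cite: Shimura1971, §8.3 (8.3.1)] -/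
@[simp] theorem coe_degeneracyPullbackZ (u : cocycles n M R) :
    ((degeneracyPullbackZ n M L d R h u : cocycles n L R) : Gamma0 L → Fin (n + 1) → R) =
      degeneracyPullback n M L d R h u := rfl

end Pullback

/-! ### Generalised Hecke eigenvectors away from a finite set of primes -/

section GenEigen

variable {n N : ℕ} {K : Type*} [Field K]

/-- `u ∈ Z¹(Γ₀(N), K^{n+1})` is a **generalised Hecke eigenvector with eigenvalues `λ` away from `S`**:
for every prime `ℓ ∉ S`, `u` lies in the generalised eigenspace of the Hecke operator
`T_ℓ = [Γ₀(N) diag(1,ℓ) Γ₀(N)]` on cocycles (`heckeUZ`, Shimura (8.3.2); this is `T_ℓ` proper when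
`ℓ ∤ N`, which the user arranges by taking `S ⊇` the primes of `N`) for the eigenvalue `λ(ℓ)` —
i.e. `u` lies in the localisation `Z¹[𝔪^∞] = Z¹_𝔪` at the maximal ideal
`𝔪 = (T_ℓ − λ(ℓ) : ℓ ∉ S)` of the commutative `K`-algebra generated by these `T_ℓ`
(Darmon–Diamond–Taylor §4.3: the Hecke algebras `𝕋_𝔪` and their modules). Written with Mathlib's
`Module.End.maxGenEigenspace`; over a field containing the eigenvalues the intersection of the
generalised eigenspaces IS the `𝔪`-primary component. [cite: DarmonDiamondTaylor1995, §4.3 (pp. 119–120)] -/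
def IsHeckeGenEigenvector (S : Finset ℕ) (lam : ℕ → K) (u : cocycles n N K) : Prop :=
  ∀ (ℓ : ℕ) [NeZero ℓ] (hℓ : ℓ.Prime), ℓ ∉ S →
    u ∈ Module.End.maxGenEigenspace (heckeUZ n N K hℓ) (lam ℓ)

/-- Unfolding `IsHeckeGenEigenvector`: for each prime `ℓ ∉ S` some power of `T_ℓ − λ(ℓ)` kills `u`.
[cite: DarmonDiamondTaylor1995, §4.3 (pp. 119–120)] -/
theorem isHeckeGenEigenvector_iff (S : Finset ℕ) (lam : ℕ → K) (u : cocycles n N K) :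
    IsHeckeGenEigenvector S lam u ↔ ∀ (ℓ : ℕ) [NeZero ℓ] (hℓ : ℓ.Prime), ℓ ∉ S →
      ∃ k : ℕ, ((heckeUZ n N K hℓ - lam ℓ • (1 : Module.End K (cocycles n N K))) ^ k) u = 0 := by
  refine forall_congr' fun ℓ ↦ forall_congr' fun _ ↦ forall_congr' fun hℓ ↦
    forall_congr' fun _ ↦ ?_
  rw [Module.End.mem_maxGenEigenspace]

/-- An honest Hecke eigenvector (`T_ℓ u = λ(ℓ) u` for all primes `ℓ ∉ S`) is a generalised one.
[cite: DarmonDiamondTaylor1995, §4.3 (pp. 119–120)] -/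
theorem isHeckeGenEigenvector_of_eigenvector (S : Finset ℕ) (lam : ℕ → K) (u : cocycles n N K)
    (hu : ∀ (ℓ : ℕ) [NeZero ℓ] (hℓ : ℓ.Prime), ℓ ∉ S → heckeUZ n N K hℓ u = lam ℓ • u) :
    IsHeckeGenEigenvector S lam u := by
  intro ℓ _ hℓ hℓS
  rw [Module.End.mem_maxGenEigenspace]
  refine ⟨1, ?_⟩
  rw [pow_one, LinearMap.sub_apply, hu ℓ hℓ hℓS, LinearMap.smul_apply, Module.End.one_apply,
    sub_self]

end GenEigen

/-! ### Degree `0`: cocycles ARE the additive homomorphisms `Γ₀(N) → R` -/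

section HomZero

variable (N : ℕ) (R : Type*) [CommRing R]

/-- **`Z¹(Γ₀(N), R) = Hom(Γ₀(N), R)` in degree `0`**: the `R`-linear identification of the degree-`0` cocycles
`u : Γ₀(N) → R¹`, `u(γδ) = u(δ) + u(γ)` (trivial coefficient action, `act_zero_eq_id`) with the additive
homomorphisms `Additive Γ₀(N) →+ R` (group cohomology `H¹(Γ, X) = Hom(Γ, X)` for a trivial `Γ`-module `X`:
Shimura §8.1, the cocycle condition (8.1.1) with `x·γ = x`). [cite: Shimura1971, §8.1 (8.1.1)] -/
def cocyclesZeroEquiv : cocycles 0 N R ≃ₗ[R] (Additive (Gamma0 N) →+ R) where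
  toFun u :=
    { toFun := fun g ↦ (u : Gamma0 N → Fin 1 → R) (Additive.toMul g) 0
      map_zero' := by
        change (u : Gamma0 N → Fin 1 → R) 1 0 = 0
        rw [cocycle_map_one u.2, Pi.zero_apply]
      map_add' := fun g h ↦ by
        change (u : Gamma0 N → Fin 1 → R) (Additive.toMul g * Additive.toMul h) 0 = _
        rw [(mem_cocycles_iff.mp u.2) (Additive.toMul g) (Additive.toMul h), act_zero_eq_id,
          LinearMap.id_apply, Pi.add_apply, add_comm] }
  map_add' u v := by ext g; rfl
  map_smul' c u := by ext g; rfl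
  invFun φ :=
    ⟨fun γ _ ↦ φ (Additive.ofMul γ), by
      rw [mem_cocycles_iff]
      intro γ δ
      funext i
      rw [act_zero_eq_id, LinearMap.id_apply, Pi.add_apply, ofMul_mul, map_add, add_comm]⟩
  left_inv u := by
    apply Subtype.ext
    funext γ i
    have hi : i = 0 := Fin.fin_one_eq_zero i
    subst hi
    rfl
  right_inv φ := by ext g; rfl

/-- Unfolding `cocyclesZeroEquiv`: the homomorphism attached to `u` is `γ ↦ u(γ)₀`.
[cite: Shimura1971, §8.1 (8.1.1)] -/
@[simp] theorem cocyclesZeroEquiv_apply (u : cocycles 0 N R) (γ : Gamma0 N) :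
    cocyclesZeroEquiv N R u (Additive.ofMul γ) = (u : Gamma0 N → Fin 1 → R) γ 0 := rfl

/-- Unfolding the inverse of `cocyclesZeroEquiv`: the cocycle attached to `φ` is `γ ↦ (φ γ)`.
[cite: Shimura1971, §8.1 (8.1.1)] -/
@[simp] theorem cocyclesZeroEquiv_symm_apply (φ : Additive (Gamma0 N) →+ R) (γ : Gamma0 N) (i : Fin 1) :
    ((cocyclesZeroEquiv N R).symm φ : Gamma0 N → Fin 1 → R) γ i = φ (Additive.ofMul γ) := rfl

end HomZero

end Literature.NumberTheory.EllipticCurves.ModularForms.HidaCohomology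

end
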